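import Summits.CriticalPhenomena.PercolationContinuityZ3.Theorems.PercFiniteBoxLROCerf2015BoxLRO16Scale
import Summits.CriticalPhenomena.PercolationContinuityZ3.Theses.PercFiniteBoxLRO
import HarnessLib

/-!
# `PercFiniteBoxLRO.Cerf2015BoxLRO16` (stmt-CriticalPhenomena-0860): Cerf 2015, Theorem 1.3 for BOND
# percolation on `ℤ³` — `θ(p) > 0 ⇒ inf_n inf_{x,y ∈ Λ(n)} P_p(x ↔ y in Λ(n^16)) > 0`

Closing file (`--workitem stmt-CriticalPhenomena-0860`) of the route decl
`Summit.CriticalPhenomena.PercolationContinuityZ3.Theses.PercFiniteBoxLRO.Cerf2015BoxLRO16`, the bond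
transcription of R. Cerf, Ann. Probab. 43 (2015), Theorem 1.3, case `d = 3` (site version in the tree:
`Literature.Probability.Percolation.Cerf2015_thm_1_3_three_holds`). Chaining the axis connections of
`…Scale.exists_axis_all` along the three coordinates (`exists_rho_large`, Harris–FKG, translation
invariance — Cerf §10, last display), the elementary bound `p^{6n}` for the small `n` and for `p = 1`
(`…Connect.pow_le_real_bconn_box`), and the identification of the statement's event `openConnIn` with the
lattice-path event `AKN.bconn` (`openConnIn_ae_eq_openConnVia`). Main theorem: `cerf2015BoxLRO16_proof`
(axioms: `propext`, `Classical.choice`, `Quot.sound`). No definition is introduced.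

## References

* R. Cerf, *A lower bound on the two-arms exponent for critical percolation on the lattice*, Ann.
  Probab. 43 (2015) 2458–2480, Thm 1.3 and §10 (arXiv:1306.3105 pp. 4, 15) [Cerf2015].
-/

noncomputable section

namespace Summit.CriticalPhenomena.PercolationContinuityZ3.Theorems

namespace Cerf2015BoxLRO16

open Literature.Probability.Percolation Literature.Probability.Percolation.AKN
  Literature.Probability.Percolation.GM Literature.Probability.LatticeModels MeasureTheory Finset Real
open scoped Classical

variable {d : ℕ}

/-- **Cerf 2015, §10, last display: "Using the FKG inequality, we conclude that `∀ n ≥ 1 ∀ x ∈ Λ(2n)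
P(0 ↔ x in Λ(6n+n^α)) ≥ ρ^d`"**, bond version on `ℤ³` with the box `Λ(n^16 − n)`: chaining the three
axis connections of `exists_axis_all` (translated, Harris–FKG). [cite: Cerf2015, §10] -/
theorem exists_rho_large (p : unitInterval) (hp0 : 0 < (p : ℝ)) (hp1 : (p : ℝ) < 1)
    (hθ : 0 < theta (zdGraph 3) 0 p) :
    ∃ N₁ : ℕ, 2 ≤ N₁ ∧ ∃ ρ : ℝ, 0 < ρ ∧ ∀ n : ℕ, N₁ ≤ n → ∀ w ∈ box 3 (2 * n),
      ρ ≤ (bondPercolation (zdGraph 3) p).real (bconn (box 3 (n ^ 16 - n)) 0 w) := by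
  obtain ⟨N₁, hN₁2, ρ₁, hρ₁, hB⟩ := exists_axis_all p hp0 hp1 hθ
  refine ⟨N₁, hN₁2, ρ₁ ^ 3, by positivity, ?_⟩
  intro n hn w hw
  set μ := bondPercolation (zdGraph 3) p with hμ
  have hn2 : 2 ≤ n := hN₁2.trans hn
  have h16 := pow_sixteen_ge hn2
  obtain ⟨B, hBdef⟩ : ∃ B : ℕ, B = n ^ 16 - 3 * n := ⟨_, rfl⟩
  have hBT : 2 * n + B = n ^ 16 - n := by omega
  set T := box 3 (n ^ 16 - n) with hT
  have hw : ∀ i, -(2 * (n : ℤ)) ≤ w i ∧ w i ≤ 2 * n := fun i => by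
    have h := (mem_box.1 hw) i; push_cast at h; exact h
  -- the legs
  have hleg : ∀ u : Site 3, ∀ i : Fin 3, ρ₁ ≤ μ.real (bconn ((box 3 B).image (· + u)) u (u + Pi.single i (w i))) := by
    intro u i
    obtain ⟨s, k, hk, hkabs⟩ := exists_units_mul_natCast (w i)
    have hk2n : k ≤ 2 * n + 1 := by
      have h1 := hw i
      have : (k : ℤ) ≤ 2 * n := by rw [hkabs, abs_le]; exact ⟨by linarith [h1.1], h1.2⟩
      omega
    have h := hB n hn i s k hk2n
    rw [← hBdef, ← hk] at h
    have ht := real_bconn_translate p (box 3 B) u 0 (Pi.single i (w i))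
    rw [zero_add, add_comm] at ht
    rw [ht]; exact h
  have hsub : ∀ u ∈ box 3 (2 * n), (box 3 B).image (· + u) ⊆ T := by
    intro u hu
    have h := ball_subset_box_add (r := B) hu
    rw [hBT] at h
    exact h
  -- the intermediate points
  set z₁ : Site 3 := Pi.single 0 (w 0) with hz₁
  set z₂ : Site 3 := z₁ + Pi.single 1 (w 1) with hz₂
  have hz₁w : z₁ = 0 + Pi.single 0 (w 0) := (zero_add _).symm
  have hwz : w = z₂ + Pi.single 2 (w 2) := by
    funext l; fin_cases l <;> simp [hz₂, hz₁]
  have hz₁mem : z₁ ∈ box 3 (2 * n) := by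
    rw [mem_box]; intro l; fin_cases l <;> simp [hz₁, hw 0]
  have hz₂mem : z₂ ∈ box 3 (2 * n) := by
    rw [mem_box]; intro l; fin_cases l <;> simp [hz₂, hz₁, hw 0, hw 1]
  have hleg0 := hleg 0 0
  rw [← hz₁w] at hleg0
  have hleg1 := hleg z₁ 1
  have hleg2 := hleg z₂ 2
  rw [← hwz] at hleg2
  have h01 := real_bconn_mul_le p (hsub 0 (zero_mem_box 3 _)) (hsub z₁ hz₁mem) 0 z₁ z₂
  have h012 := real_bconn_mul_le p (subset_refl T) (hsub z₂ hz₂mem) 0 z₂ w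
  calc ρ₁ ^ 3 = ρ₁ * ρ₁ * ρ₁ := by ring
    _ ≤ μ.real (bconn ((box 3 B).image (· + (0 : Site 3))) 0 z₁) * μ.real (bconn ((box 3 B).image (· + z₁)) z₁ z₂) *
          μ.real (bconn ((box 3 B).image (· + z₂)) z₂ w) :=
        mul_le_mul (mul_le_mul hleg0 hleg1 hρ₁.le measureReal_nonneg) hleg2 hρ₁.le
          (mul_nonneg measureReal_nonneg measureReal_nonneg)
    _ ≤ μ.real (bconn T 0 z₂) * μ.real (bconn ((box 3 B).image (· + z₂)) z₂ w) :=
        mul_le_mul_of_nonneg_right h01 measureReal_nonneg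
    _ ≤ μ.real (bconn T 0 w) := h012

end Cerf2015BoxLRO16

open Literature.Probability.Percolation Literature.Probability.Percolation.AKN
  Literature.Probability.LatticeModels MeasureTheory in
/-- **Cerf 2015, Theorem 1.3 (`d = 3`), transcribed to BOND percolation on `ℤ³`** — the route's
support item `Cerf2015BoxLRO16`: if `θ(p) > 0` then there is `ρ > 0` such that for all `n ≥ 1` and all
`x, y ∈ Λ(n)`, `P_p(x ↔ y by an open path inside Λ(n^16)) ≥ ρ` (R. Cerf, Ann. Probab. 43 (2015),
Thm 1.3: "For `d = 3`, this gives: `∃ ρ > 0 ∀ n ≥ 1 ∀ x, y ∈ Λ(n) P_p(x ↔ y in Λ(n^16)) ≥ ρ`", written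
there for site percolation; here the Aizenman–Kesten–Newman / Gandolfi–Grimmett–Russo counting is
run for bonds — `AKN.*` in the tree and the helper files `…Cerf2015BoxLRO16{Counting,Covering,Decay,
Dyadic,SectionTen}` — with one step of the §8–§9 exponent improvement, which the box `Λ(n^16)`
requires). For `p = 1` and for `n` below the threshold the bound is the elementary `p^{6n}`.
[cite: Cerf2015, Thm 1.3 (case d = 3)] -/
theorem cerf2015BoxLRO16_proof :
    Summit.CriticalPhenomena.PercolationContinuityZ3.Theses.PercFiniteBoxLRO.Cerf2015BoxLRO16 := by
  intro p hθ
  -- `p > 0`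
  have hp0 : 0 < (p : ℝ) := by
    rcases eq_or_lt_of_le p.2.1 with h | h
    · exfalso
      have hp : p = 0 := Subtype.ext h.symm
      rw [hp, theta_bot] at hθ
      exact lt_irrefl _ hθ
    · exact h
  have hnn : ∀ n : ℕ, 1 ≤ n → n ≤ n ^ 16 := fun n _ => Nat.le_self_pow (by norm_num) n
  -- `{x ↔ y in Λ}` of the statement is a.s. the lattice-path event `bconn`
  have hconv : ∀ n : ℕ, 1 ≤ n → ∀ x y : Site 3, x ∈ box 3 n →
      (bondPercolation (zdGraph 3) p).real (openConnIn ↑(box 3 (n ^ 16)) x y) =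
        (bondPercolation (zdGraph 3) p).real (AKN.bconn (box 3 (n ^ 16)) x y) := by
    intro n hn x y hx
    have hx' : x ∈ (↑(box 3 (n ^ 16)) : Set (Site 3)) := Finset.mem_coe.2 (box_mono 3 (hnn n hn) hx)
    exact measureReal_congr (openConnIn_ae_eq_openConnVia (zdGraph 3) p hx' y)
  -- the elementary bound, every `n`
  have hsmall : ∀ n : ℕ, 1 ≤ n → ∀ x ∈ box 3 n, ∀ y ∈ box 3 n,
      (p : ℝ) ^ (6 * n) ≤ (bondPercolation (zdGraph 3) p).real (openConnIn ↑(box 3 (n ^ 16)) x y) := by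
    intro n hn x hx y hy
    rw [hconv n hn x y hx]
    exact (Cerf2015BoxLRO16.pow_le_real_bconn_box p hx hy).trans (measureReal_mono
      (openConnVia_mono_graph (withinGraph_mono _ (Finset.coe_subset.2 (box_mono 3 (hnn n hn)))) x y) (measure_ne_top _ _))
  by_cases hp1 : (p : ℝ) = 1
  · refine ⟨1 / 2, by norm_num, fun n hn x hx y hy => ?_⟩
    have h := hsmall n hn x hx y hy
    rw [hp1, one_pow] at h
    linarith
  have hp1' : (p : ℝ) < 1 := lt_of_le_of_ne p.2.2 hp1
  obtain ⟨N₁, hN₁2, ρ, hρ, hC⟩ := Cerf2015BoxLRO16.exists_rho_large p hp0 hp1' hθ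
  refine ⟨min ρ ((p : ℝ) ^ (6 * N₁)), lt_min hρ (by positivity), ?_⟩
  intro n hn x hx y hy
  by_cases hnN : N₁ ≤ n
  · rw [hconv n hn x y hx]
    have hw : y - x ∈ box 3 (2 * n) := by
      rw [mem_box] at hx hy ⊢
      intro l; have h1 := hx l; have h2 := hy l
      rw [Pi.sub_apply]; push_cast; constructor <;> linarith [h1.1, h1.2, h2.1, h2.2]
    have h := hC n hnN (y - x) hw
    have ht := AKN.real_bconn_translate p (box 3 (n ^ 16 - n)) x 0 (y - x)
    rw [zero_add, sub_add_cancel] at ht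
    have hsub : (box 3 (n ^ 16 - n)).image (· + x) ⊆ box 3 (n ^ 16) := by
      have h' := Cerf2015BoxLRO16.ball_subset_box_add (r := n ^ 16 - n) hx
      have heq : n + (n ^ 16 - n) = n ^ 16 := by have := hnn n hn; omega
      rw [heq] at h'
      exact h'
    calc min ρ ((p : ℝ) ^ (6 * N₁)) ≤ ρ := min_le_left _ _
      _ ≤ _ := h
      _ = _ := ht.symm
      _ ≤ _ := measureReal_mono (openConnVia_mono_graph (withinGraph_mono _ (Finset.coe_subset.2 hsub)) x y)
          (measure_ne_top _ _)
  · push Not at hnN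
    calc min ρ ((p : ℝ) ^ (6 * N₁)) ≤ (p : ℝ) ^ (6 * N₁) := min_le_right _ _
      _ ≤ (p : ℝ) ^ (6 * n) := pow_le_pow_of_le_one p.2.1 p.2.2 (by omega)
      _ ≤ _ := hsmall n hn x hx y hy

end Summit.CriticalPhenomena.PercolationContinuityZ3.Theorems

end
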